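import Summits.ABC.StewartYu.PadicG3TwoSchedule
import HarnessLib

/-!
# Cell abc-stewartyu, Gen-3 frame at `p = 2` (crux `Y07Two`, stmt-ABC-19659), record interface (sequel): the frame
# numerics `FrameNumericsTwoC` of the `p = 2` schedule `schedTwo` REDUCED TO THE BUDGET LINES

`Summits/ABC/StewartYu/PadicG3TwoScheduleNumerics.lean` — cell `abc-stewartyu` (HOME `run/shared/lean/pub/abc-stewartyu/`),
route `PadicPrimesKummerThird`, seat p5 (g3); sequel to `PadicG3TwoSchedule.lean`.  Theorems only.

`kfinalTwo_schedTwo` / `thirdFinalTwo_schedTwo`: the inner-chain and third-step obligation structures of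
`schedTwo S P` at a level with decrement `T3 I ≥ 8`, from the k-step lines (L2) resp. the third-step line (L3) —
every bookkeeping field (sub-schedule consistency, order budget `T03`, box recursion, directional bound, denominators,
positivity of the Liouville constant) discharged by construction.  **`frameNumericsTwoC_schedTwo`**: the whole
`FrameNumericsTwoC (schedTwo S P) P.H P.L₀` from the depth fit `8·3^{I*} ≤ 4L`, (L1) the binomial Siegel count, (L2),
(L3) — the hypotheses are stated on the projections of `schedTwo` (rewrite with `schedTwo_*`).  With
`PadicG3TwoFrameNumericsSharp.stub_frameTwoLast_of_numericsC` this leaves for crux stmt-ABC-19659 exactly: (L1)–(L3),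
the depth fit, the slab smallness `‖Λ₀‖ ≤ 2^{−(m+3)}`, the END ranges and `RecordTwo` for the triadic END data.

WHAT THIS IS NOT: the budget lines (record, HOME/p5/SCHEDULE-p2-v0.md §2–§3); no crux moves.

References: Yu. V. Nesterenko, LNM 1819 (2003), §4 (4.3)–(4.5); K. Yu, Acta Math. 211 (2013), Lemma 5.2, Lemma 5.4.
-/

noncomputable section

open Finset Polynomial
open Literature.NumberTheory.Transcendental
open Literature.NumberTheory.Transcendental (FeldmanDelta.den)
open Literature.NumberTheory.Transcendental.FeldmanDelta
open Literature.NumberTheory.Transcendental.CW77.Setup (Tau tauNorm)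
open Literature.NumberTheory.Transcendental.PadicCW77 (condExp)

namespace Summit.ABC.StewartYu

namespace TwoSetup

open Summit.ABC.StewartYu.FeldmanBasis Summit.ABC.StewartYu.G3Boxes

variable (S : TwoSetup) (P : PadicG3Par (S.d + 1))

/-! ### The frame numerics from the budget lines -/

/-- The order bookkeeping of a level: start order minus the `d + 2` k-steps leaves the third step at least
`T3 I` when `T3 I ≥ 8`. [folklore] -/
theorem T03_budget (I : ℕ) (hT : 8 ≤ S.T3 P I) :
    (S.d + 2) * S.T3 P I ≤ S.T03 P I ∧
    S.T03 P (I + 1) + 1 + (S.d + 2) * S.T3 P I ≤ S.T03 P I := by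
  have hT3 := S.T3_succ_le P I
  have h3 : 3 * S.T3 P (I + 1) ≤ S.T3 P I := (Nat.mul_le_mul_left 3 hT3).trans (Nat.mul_div_le _ 3)
  unfold T03
  generalize P.M / (S.d + 1 + 2) ^ 3 = M₃
  generalize S.T3 P I = T at hT h3 ⊢
  generalize S.T3 P (I + 1) = T' at h3 ⊢
  constructor
  · nlinarith
  · nlinarith [h3, hT]

/-- **The inner-chain obligations of the `p = 2` schedule at level `I`** from the k-step lines (L2).
[cite: Nesterenko2003, §4 (4.3)–(4.5); shape only] -/
theorem kfinalTwo_schedTwo (I : ℕ) (hT : 8 ≤ S.T3 P I)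
    (hL2 : ∀ k, k < (S.schedTwo P).kst I → ∀ x₁ : ℤ, |x₁| ≤ ((S.schedTwo P).Nsub I (k + 1) : ℤ) →
      ∀ τ : Tau S.d, tauNorm τ + (S.schedTwo P).tdec I ≤ (S.schedTwo P).T0 I - k * (S.schedTwo P).tdec I →
      max ((S.schedTwo P).Bw I * ‖S.Λ₀‖ * (2 : ℝ) ^ (S.schedTwo P).tdec I *
            (2 : ℝ) ^ condExp 2 (2 * (S.schedTwo P).Nsub I k + 1) ((S.schedTwo P).tdec I))
          ((S.schedTwo P).Bw I / (4 * (2 : ℝ) ^ (S.schedTwo P).m) ^ gainExp (S.schedTwo P) I k) <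
        1 / KTwo (S.schedTwo P) I x₁ τ) :
    KFinalTwo (S.schedTwo P) I where
  Nsub_zero := rfl
  Nfin_le := by
    rw [schedTwo_Nfin, schedTwo_Nsub, schedTwo_kst]
    unfold Nsub3
    rw [if_neg (by omega)]
  Tfin_le := by
    rw [schedTwo_Tfin, schedTwo_kst, schedTwo_tdec, schedTwo_T0]
    have := (S.T03_budget P I hT).1
    omega
  one_le_kst := by rw [schedTwo_kst]; omega
  one_le_tdec := by rw [schedTwo_tdec]; omega
  Xb_nonneg := S.Xb3_nonneg P I
  one_le_den₀ := fun _ _ => Nat.one_le_pow _ _ (Nat.lcmUpto_pos P.H)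
  KTwo_pos := S.KTwo_schedTwo_pos P I
  hfinal := hL2

/-- **The third-step obligations of the `p = 2` schedule at level `I`** from the third-step line (L3).
[cite: Yu2013, Lemma 5.4; shape only] -/
theorem thirdFinalTwo_schedTwo (I : ℕ) (hT : 8 ≤ S.T3 P I)
    (hL3 : ∀ s : ℤ, |s| ≤ ((S.schedTwo P).N0 (I + 1) : ℤ) → ¬ (3 : ℤ) ∣ s → ∀ τ : Tau S.d,
      tauNorm τ < (S.schedTwo P).T0 (I + 1) →
      max ((S.schedTwo P).Bw I * ‖S.Λ₀‖ * (2 : ℝ) ^ ((S.schedTwo P).Tfin I - (S.schedTwo P).T0 (I + 1)) *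
            (2 : ℝ) ^ condExp 2 (2 * (S.schedTwo P).Nfin I + 1)
              ((S.schedTwo P).Tfin I - (S.schedTwo P).T0 (I + 1)))
          ((S.schedTwo P).Bw I / (4 * (2 : ℝ) ^ (S.schedTwo P).m) ^
            ((2 * (S.schedTwo P).Nfin I + 1) * ((S.schedTwo P).Tfin I - (S.schedTwo P).T0 (I + 1)))) <
        1 / (6 * (thirdDen (S.schedTwo P) I s τ : ℝ) * thirdM (S.schedTwo P) I s τ *
          CW77.heightProd S.toQ.all ^ 5) ^ (3 ^ (S.d + 1 + 1) - 1)) :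
    ThirdFinalTwo (S.schedTwo P) I where
  tthird_pos := by
    rw [schedTwo_Tfin, schedTwo_T0]
    have h1 := (S.T03_budget P I hT).1
    have h2 := (S.T03_budget P I hT).2
    omega
  T0_succ_le := by
    rw [schedTwo_Tfin, schedTwo_T0]
    have h1 := (S.T03_budget P I hT).1
    have h2 := (S.T03_budget P I hT).2
    omega
  cardB_mono := le_rfl
  Bw_mono := le_rfl
  Dbox_succ := fun j => by rw [schedTwo_Dbox]; exact (S.Dbox3_succ P I j).le
  Dθ_succ := by rw [schedTwo_Dθ]; exact (S.Dθ3_succ P I).le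
  Xb_succ := fun j => by rw [schedTwo_Dbox, schedTwo_Dθ, schedTwo_Xb]; exact S.Xb3_ge P (I + 1) j
  one_le_den₀ := fun _ _ => Nat.one_le_pow _ _ (Nat.lcmUpto_pos P.H)
  hfinal := hL3

/-- **THE FRAME NUMERICS OF THE `p = 2` SCHEDULE FROM THE BUDGET LINES**: (L1) the binomial Siegel count, (L2)
the k-step inequalities at every level `I ≤ I*`, (L3) the third-step inequalities at every `I < I*`, and the depth
fit `8·3^{I*} ≤ 4L` (so every decrement `T3 I ≥ 8`); everything else of `FrameNumericsTwoC` holds by construction.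
(The lines are stated on the projections of `schedTwo`; rewrite with the `schedTwo_*` lemmas.)
[cite: Nesterenko2003, §4 (4.3)–(4.5) and Prop 3.9; shape only] -/
theorem frameNumericsTwoC_schedTwo
    (hdepth : 8 * 3 ^ S.Istar3 P ≤ 4 * P.L)
    (hL1 : 2 * 2 ^ (S.schedTwo P).m *
        ((2 * (S.schedTwo P).N0 0 + 1) * ((S.schedTwo P).T0 0 + S.d).choose (S.d + 1)) ≤
      (P.L₀ + 1) * ((∏ j, (2 * (S.schedTwo P).Dbox 0 j + 1)) * (2 * (S.schedTwo P).Dθ 0 + 1)))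
    (hL2 : ∀ I, I ≤ S.Istar3 P → ∀ k, k < (S.schedTwo P).kst I → ∀ x₁ : ℤ,
      |x₁| ≤ ((S.schedTwo P).Nsub I (k + 1) : ℤ) →
      ∀ τ : Tau S.d, tauNorm τ + (S.schedTwo P).tdec I ≤ (S.schedTwo P).T0 I - k * (S.schedTwo P).tdec I →
      max ((S.schedTwo P).Bw I * ‖S.Λ₀‖ * (2 : ℝ) ^ (S.schedTwo P).tdec I *
            (2 : ℝ) ^ condExp 2 (2 * (S.schedTwo P).Nsub I k + 1) ((S.schedTwo P).tdec I))
          ((S.schedTwo P).Bw I / (4 * (2 : ℝ) ^ (S.schedTwo P).m) ^ gainExp (S.schedTwo P) I k) <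
        1 / KTwo (S.schedTwo P) I x₁ τ)
    (hL3 : ∀ I, I < S.Istar3 P → ∀ s : ℤ, |s| ≤ ((S.schedTwo P).N0 (I + 1) : ℤ) → ¬ (3 : ℤ) ∣ s →
      ∀ τ : Tau S.d, tauNorm τ < (S.schedTwo P).T0 (I + 1) →
      max ((S.schedTwo P).Bw I * ‖S.Λ₀‖ * (2 : ℝ) ^ ((S.schedTwo P).Tfin I - (S.schedTwo P).T0 (I + 1)) *
            (2 : ℝ) ^ condExp 2 (2 * (S.schedTwo P).Nfin I + 1)
              ((S.schedTwo P).Tfin I - (S.schedTwo P).T0 (I + 1)))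
          ((S.schedTwo P).Bw I / (4 * (2 : ℝ) ^ (S.schedTwo P).m) ^
            ((2 * (S.schedTwo P).Nfin I + 1) * ((S.schedTwo P).Tfin I - (S.schedTwo P).T0 (I + 1)))) <
        1 / (6 * (thirdDen (S.schedTwo P) I s τ : ℝ) * thirdM (S.schedTwo P) I s τ *
          CW77.heightProd S.toQ.all ^ 5) ^ (3 ^ (S.d + 1 + 1) - 1)) :
    FrameNumericsTwoC (S.schedTwo P) P.H P.L₀ := by
  have hH : 1 ≤ P.H := le_max_left _ _
  have hT8 : ∀ I, I ≤ S.Istar3 P → 8 ≤ S.T3 P I := by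
    intro I hI
    unfold T3
    have h3 : 3 ^ I ≤ 3 ^ S.Istar3 P := Nat.pow_le_pow_right (by norm_num) hI
    have hpos : 0 < 3 ^ I := by positivity
    rw [Nat.le_div_iff_mul_le hpos]
    calc 8 * 3 ^ I ≤ 8 * 3 ^ S.Istar3 P := Nat.mul_le_mul_left _ h3
      _ ≤ 4 * P.L := hdepth
  refine
    { one_le_H := hH
      T0_pos := S.one_le_T03 P 0
      count := hL1
      cardB0 := le_rfl
      L_le := le_rfl
      Xb0 := ?_
      Bw0 := fun ℓ hℓ => S.Bw3_ge P ℓ hℓ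
      den₀_eq := fun _ _ _ => rfl
      M₀_ge := fun I _ x τ ℓ hℓ => S.M₀3_ge P I x τ ℓ hℓ
      level0_size := ?_
      kfinal := fun I hI => S.kfinalTwo_schedTwo P I (hT8 I hI) (hL2 I hI)
      third := fun I hI => S.thirdFinalTwo_schedTwo P I (hT8 I hI.le) (hL3 I hI) }
  · -- `Xb0` on the box
    intro i hi j
    rw [schedTwo_Xb]
    rw [schedTwo_Dbox, schedTwo_Dθ] at hi
    have hb := (mem_famBox.mp hi).2
    exact (S.abs_dirScalar_le hb.1 hb.2 j).trans (S.Xb3_ge P 0 j)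
  · -- `level0_size` by the exact finite maxima
    refine ⟨S.M₀E3 P (S.one_le_T03 P 0), S.Amax3 P (S.one_le_T03 P 0), ?_, le_max_left _ _, ?_, ?_⟩
    · intro e he
      rw [schedTwo_M₀]
      rw [schedTwo_N0, schedTwo_T0, Nsub3_zero_zero] at he
      exact S.M₀3_le_M₀E3 P _ he
    · intro e he
      rw [schedTwo_Xb, schedTwo_Dbox, schedTwo_Dθ]
      rw [schedTwo_N0, schedTwo_T0, Nsub3_zero_zero] at he
      exact S.prod_le_Amax3 P _ he
    · rw [schedTwo_P, schedTwo_Dbox, schedTwo_Dθ]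

end TwoSetup

end Summit.ABC.StewartYu

end
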